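import Mathlib
import HarnessLib
import Summits.QuantumFields.YangMills.Theorems.MirrorModularBoostsHypercubicLimitFlatShellDecomposition

/-!
# `CoincidenceRotationBootstrap.HypercubicLimit`, line `Sketch` (coupling response): flat dyadic shells
with explicit constants

Stub `flatShellDecomposition_explicit` (step Z1, explicit form of piece E3) of crux
`stmt-QuantumFields-16154` (`Summit.QuantumFields.YangMills.Theses.CoincidenceRotationBootstrap.HypercubicLimit`),
line `Sketch`.

Informal statement. Fix `B ≥ 1` and suppose that for every scale `κ ≥ 1` there is a smooth off-diagonal
cut-off `ψ_κ` on `(ℝ⁴)ⁿ` with `0 ≤ ψ_κ ≤ 1`, `ψ_κ = 1` where all pairwise distances are `≥ 2/κ`,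
`ψ_κ = 0` where some pairwise distance is `≤ 1/κ`, and `‖D^l ψ_κ‖ ≤ (B κ)^l (l!)^3`. Let
`F ∈ ⁰𝒮((ℝ⁴)ⁿ)` be flat on the coincidence locus (`IsOffDiagonal F`), compactly supported, and supported
at pairwise distances `≥ δ > 0`. Then for all orders `t'` and decay rates `N`, `F = Σ_{j<J} u_j` with
compactly supported Schwartz functions `u_j` supported at pairwise distances `≥ 2^{-(j+1)}` and
`|u_j|_{t'} ≤ (64 B)^{t'+1} 2^N (t'!)^3 2^{-N j} |F|_{2t'+N+1}`.

Proof. The proof of `flatShellDecomposition` (the version with unspecified constants) with the constants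
threaded through. The dyadic subfamily is `η_j = ψ_{2^{j+1}}` (`η_j = 1` where all distances are
`≥ 2^{-j}`, `η_j = 0` where some distance is `≤ 2^{-(j+1)}`, `‖D^l η_j‖ ≤ B^l (l!)^3 2^{(j+1) l}`), the
shell cut-offs are `W_0 = η_0`, `W_{j+1} = η_{j+1} - η_j` (`‖D^l W_j‖ ≤ 2 B^l (l!)^3 2^{(j+1) l}`), and the
shells are `u_j = W_j F`; they telescope to `η_{J'} F = F` once `2^{-J'} < δ`, and `u_j` vanishes near
every point with a pair at distance `< 2^{-(j+1)}`. For `j ≥ 1` the cut-off `W_j` is supported where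
some pair is at distance `≤ 2^{1-j} ≤ 1`, and there `F` is flat: merging the close pair
(`pow_mul_norm_iteratedFDeriv_le_of_pair`) gives `‖x‖^k ‖D^m F(x)‖ ≤ 4^k |F|_{2t'+N+1} 2^{(1-j)(N+l+1)}`
for `m ≤ l ≤ t'`, `k ≤ t'`; Leibniz (`pow_mul_norm_iteratedFDeriv_smul_le_of_le`) with
`‖D^c W_j‖ ≤ 2 B^{t'} (t'!)^3 2^{(j+1) c}` (`c ≤ t'`, using `B ≥ 1`, `c! ≤ t'!`) bounds every Schwartz
seminorm of order `≤ t'` of `u_j` by `2^{3t'+N} 4^{t'} · 2 B^{t'} (t'!)^3 · 2^{-N j} |F|_{2t'+N+1}`, and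
`2^{3t'+N} 4^{t'} 2 B^{t'} = 2^{5t'+N+1} B^{t'} ≤ 64^{t'+1} 2^N B^{t'+1}`. References: folklore (dyadic
Whitney-type decomposition near a closed set; L. Hörmander, The Analysis of Linear Partial Differential
Operators I (1990), §1.4 and Lemma 7.1.8; K. Osterwalder, R. Schrader, Comm. Math. Phys. 42 (1975) §2,
the norms `|·|_m` on `⁰𝒮`). [folklore]
-/

noncomputable section

open scoped SchwartzMap ContDiff
open MeasureTheory Filter Topology Literature.MathematicalPhysics.AQFT Literature.MathematicalPhysics.QuantumLattice

namespace Summit.QuantumFields.YangMills.Cruxes.HypercubicLimit.CouplingResponse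

/-! ## Dyadic shell cut-offs with explicit constants -/

/-- **Dyadic shell cut-offs, explicit constants.** From an off-diagonal cut-off family `ψ_κ` (`κ ≥ 1`;
`ψ_κ = 1` where all pairwise distances are `≥ 2/κ`, `ψ_κ = 0` where some distance is `≤ 1/κ`,
`‖D^l ψ_κ‖ ≤ (B κ)^l (l!)^3`) put `η_j = ψ_{2^{j+1}}` and `W_0 = η_0`, `W_{j+1} = η_{j+1} - η_j`. Then
`W_j` is smooth with `‖D^l W_j‖ ≤ 2 B^l (l!)^3 2^{(j+1) l}`, `W_j(x) = 0` as soon as some pair of `x` is at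
distance `< 2^{-(j+1)}`, `W_{j+1}(x) = 0` as soon as all pairs are at distance `≥ 2^{-j}`, and
`Σ_{j ≤ J} W_j(x) = η_J(x) = 1` when all pairs are at distance `≥ 2^{-J}` (telescoping). [folklore] -/
theorem exists_dyadicShellCutoffs_of_family {n : ℕ} {B : ℝ} (hB : 0 ≤ B)
    (hψ : ∀ κ : ℝ, 1 ≤ κ → ∃ ψ : (Fin n → EuclideanSpace ℝ (Fin 4)) → ℝ, ContDiff ℝ ∞ ψ ∧
      (∀ x, 0 ≤ ψ x ∧ ψ x ≤ 1) ∧ (∀ x, (∀ i j, i ≠ j → 2 / κ ≤ ‖x i - x j‖) → ψ x = 1) ∧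
      (∀ x, (∃ i j, i ≠ j ∧ ‖x i - x j‖ ≤ 1 / κ) → ψ x = 0) ∧
      ∀ (l : ℕ) (x : Fin n → EuclideanSpace ℝ (Fin 4)),
        ‖iteratedFDeriv ℝ l ψ x‖ ≤ (B * κ) ^ l * ((l.factorial : ℝ)) ^ 3) :
    ∃ W : ℕ → (Fin n → EuclideanSpace ℝ (Fin 4)) → ℝ,
      (∀ j, ContDiff ℝ ∞ (W j)) ∧
      (∀ j l x, ‖iteratedFDeriv ℝ l (W j) x‖ ≤
        2 * (B ^ l * (l.factorial : ℝ) ^ 3) * 2 ^ ((j + 1) * l)) ∧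
      (∀ j x, (∃ i i' : Fin n, i ≠ i' ∧ ‖x i - x i'‖ < (2 : ℝ)⁻¹ ^ (j + 1)) → W j x = 0) ∧
      (∀ j x, (∀ i i' : Fin n, i ≠ i' → (2 : ℝ)⁻¹ ^ j ≤ ‖x i - x i'‖) → W (j + 1) x = 0) ∧
      (∀ J x, (∀ i i' : Fin n, i ≠ i' → (2 : ℝ)⁻¹ ^ J ≤ ‖x i - x i'‖) →
        ∑ j ∈ Finset.range (J + 1), W j x = 1) := by
  -- the derivative constants `C l = B^l (l!)^3`
  obtain ⟨C, hC⟩ : ∃ C : ℕ → ℝ, ∀ l, C l = B ^ l * (l.factorial : ℝ) ^ 3 := ⟨_, fun _ => rfl⟩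
  have hC0 : ∀ l, 0 ≤ C l := fun l => by rw [hC]; positivity
  -- the dyadic subfamily `η j = ψ (2^(j+1))`, of scale parameter `κ = 2^(j+1)`
  have h2j : ∀ j : ℕ, (2 : ℝ) / 2 ^ (j + 1) = 2⁻¹ ^ j := fun j => by
    rw [inv_pow, pow_succ]; field_simp
  have h1j : ∀ j : ℕ, (1 : ℝ) / 2 ^ (j + 1) = 2⁻¹ ^ (j + 1) := fun j => by rw [one_div, inv_pow]
  have hhalf : ∀ j : ℕ, (2 : ℝ)⁻¹ ^ (j + 1) ≤ 2⁻¹ ^ j := fun j =>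
    pow_le_pow_of_le_one (by norm_num) (by norm_num) (Nat.le_succ j)
  choose η hηs _ hη1' hη0' hηC' using fun j : ℕ => hψ (2 ^ (j + 1)) (one_le_pow₀ one_le_two)
  have hη1 : ∀ j x, (∀ i i' : Fin n, i ≠ i' → (2 : ℝ)⁻¹ ^ j ≤ ‖x i - x i'‖) → η j x = 1 :=
    fun j x hx => hη1' j x fun i i' hii' => by rw [h2j]; exact hx i i' hii'
  have hη0 : ∀ j x, (∃ i i' : Fin n, i ≠ i' ∧ ‖x i - x i'‖ ≤ (2 : ℝ)⁻¹ ^ (j + 1)) → η j x = 0 := by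
    rintro j x ⟨i, i', hii', hle⟩
    exact hη0' j x ⟨i, i', hii', by rwa [h1j]⟩
  have hηC : ∀ j l x, ‖iteratedFDeriv ℝ l (η j) x‖ ≤ C l * 2 ^ ((j + 1) * l) := by
    intro j l x
    refine (hηC' j l x).trans_eq ?_
    rw [hC, mul_pow, ← pow_mul]
    ring
  -- `ηm j = η (j - 1)` with `ηm 0 = 0`
  obtain ⟨ηm, hηm0, hηmS⟩ : ∃ ηm : ℕ → (Fin n → EuclideanSpace ℝ (Fin 4)) → ℝ,
      ηm 0 = 0 ∧ ∀ j, ηm (j + 1) = η j :=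
    ⟨fun j => match j with | 0 => 0 | i + 1 => η i, rfl, fun _ => rfl⟩
  have hηms : ∀ j, ContDiff ℝ ∞ (ηm j) := by
    rintro (_ | j)
    · rw [hηm0]; exact contDiff_const
    · rw [hηmS]; exact hηs j
  have hηmC : ∀ j l x, ‖iteratedFDeriv ℝ l (ηm j) x‖ ≤ C l * 2 ^ ((j + 1) * l) := by
    rintro (_ | j) l x
    · rw [hηm0, iteratedFDeriv_zero, Pi.zero_apply, norm_zero]
      exact mul_nonneg (hC0 l) (by positivity)
    · rw [hηmS]
      refine (hηC j l x).trans (mul_le_mul_of_nonneg_left (pow_le_pow_right₀ one_le_two ?_) (hC0 l))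
      exact Nat.mul_le_mul_right l (Nat.le_succ _)
  obtain ⟨W, hW⟩ : ∃ W : ℕ → (Fin n → EuclideanSpace ℝ (Fin 4)) → ℝ, ∀ j, W j = η j - ηm j :=
    ⟨_, fun _ => rfl⟩
  have htel : ∀ (J : ℕ) x, ∑ j ∈ Finset.range J, W j x = ηm J x := by
    intro J x
    induction J with
    | zero => simp [hηm0]
    | succ J ih => rw [Finset.sum_range_succ, ih, hηmS, hW, Pi.sub_apply]; ring
  refine ⟨W, fun j => by rw [hW]; exact (hηs j).sub (hηms j), fun j l x => ?_, fun j x hx => ?_,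
    fun j x hx => ?_, fun J x hx => ?_⟩
  · rw [hW, iteratedFDeriv_sub_apply ((hηs j).of_le (mod_cast le_top)).contDiffAt
      ((hηms j).of_le (mod_cast le_top)).contDiffAt, ← hC]
    calc ‖iteratedFDeriv ℝ l (η j) x - iteratedFDeriv ℝ l (ηm j) x‖
        ≤ ‖iteratedFDeriv ℝ l (η j) x‖ + ‖iteratedFDeriv ℝ l (ηm j) x‖ := norm_sub_le _ _
      _ ≤ C l * 2 ^ ((j + 1) * l) + C l * 2 ^ ((j + 1) * l) := add_le_add (hηC j l x) (hηmC j l x)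
      _ = 2 * C l * 2 ^ ((j + 1) * l) := by ring
  · obtain ⟨i, i', hii', hlt⟩ := hx
    rw [hW, Pi.sub_apply, hη0 j x ⟨i, i', hii', hlt.le⟩]
    rcases j with _ | j
    · rw [hηm0, Pi.zero_apply, sub_zero]
    · rw [hηmS, hη0 j x ⟨i, i', hii', hlt.le.trans (hhalf (j + 1))⟩, sub_zero]
  · rw [hW, Pi.sub_apply, hηmS, hη1 j x hx,
      hη1 (j + 1) x fun i i' hii' => (hhalf j).trans (hx i i' hii'), sub_self]
  · rw [htel, hηmS]
    exact hη1 J x hx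

/-! ## The decomposition -/

/-- **Stub `flatShellDecomposition_explicit` (Z1, explicit E3): flat dyadic shells with explicit
constants.** Given `B ≥ 1` and an off-diagonal cut-off family `ψ_κ` (`κ ≥ 1`) with
`‖D^l ψ_κ‖ ≤ (B κ)^l (l!)^3`, a compactly supported `F ∈ ⁰𝒮((ℝ⁴)ⁿ)` supported at pairwise distances
`≥ δ > 0` decomposes as `F = Σ_{j<J} u_j` with compactly supported Schwartz `u_j` supported at pairwise
distances `≥ 2^{-(j+1)}` and `|u_j|_{t'} ≤ (64 B)^{t'+1} 2^N (t'!)^3 2^{-N j} |F|_{2t'+N+1}`: the shells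
`u_j = W_j F` of the dyadic cut-offs (`exists_dyadicShellCutoffs_of_family`), Leibniz, and the flatness
of `F` at the coincidence locus on the support of `W_j` (`j ≥ 1`), where some pair is at distance
`≤ 2^{1-j}`. [folklore] -/
theorem flatShellDecomposition_explicit : ∀ (n : ℕ) (B : ℝ), 1 ≤ B → (∀ κ : ℝ, 1 ≤ κ → ∃ ψ : (Fin n → EuclideanSpace ℝ (Fin 4)) → ℝ, ContDiff ℝ ∞ ψ ∧ (∀ x, 0 ≤ ψ x ∧ ψ x ≤ 1) ∧ (∀ x, (∀ i j, i ≠ j → 2 / κ ≤ ‖x i - x j‖) → ψ x = 1) ∧ (∀ x, (∃ i j, i ≠ j ∧ ‖x i - x j‖ ≤ 1 / κ) → ψ x = 0) ∧ ∀ (l : ℕ) (x : Fin n → EuclideanSpace ℝ (Fin 4)), ‖iteratedFDeriv ℝ l ψ x‖ ≤ (B * κ) ^ l * ((l.factorial : ℝ)) ^ 3) → ∀ (t' N : ℕ) (F : 𝓢((Fin n → EuclideanSpace ℝ (Fin 4)), ℂ)), IsOffDiagonal F → HasCompactSupport (F : (Fin n → EuclideanSpace ℝ (Fin 4)) → ℂ)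 → (∃ δ : ℝ, 0 < δ ∧ ∀ x ∈ tsupport (F : (Fin n → EuclideanSpace ℝ (Fin 4)) → ℂ), ∀ i j, i ≠ j → δ ≤ ‖x i - x j‖) → ∃ (J : ℕ) (u : ℕ → 𝓢((Fin n → EuclideanSpace ℝ (Fin 4)), ℂ)), F = ∑ j ∈ Finset.range J, u j ∧ ∀ j, HasCompactSupport (u j : (Fin n → EuclideanSpace ℝ (Fin 4)) → ℂ) ∧ (∀ x ∈ tsupport (u j : (Fin n → EuclideanSpace ℝ (Fin 4)) → ℂ), ∀ i i', i ≠ i' → (2 : ℝ)⁻¹ ^ (j + 1) ≤ ‖x i - x i'‖) ∧ schwartzNorm t' (u j) ≤ (64 * B) ^ (t' + 1) * (2 : ℝ) ^ N * ((t'.factorial : ℝ)) ^ 3 * (2 : ℝ)⁻¹ ^ (N * j) * schwartzNorm (2 * t' + N + 1) F := by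
  intro n B hB hψ t' N
  have hB0 : 0 ≤ B := zero_le_one.trans hB
  obtain ⟨W, hWs, hWC, hW0, hW1, hWsum⟩ := exists_dyadicShellCutoffs_of_family hB0 hψ
  -- a common bound for the cut-off constants of order `≤ t'`
  obtain ⟨Amax, hAmaxB, hAmax0, hAmax⟩ : ∃ Amax : ℝ, Amax = 2 * (B ^ t' * (t'.factorial : ℝ) ^ 3) ∧
      0 ≤ Amax ∧ ∀ l ≤ t', 2 * (B ^ l * (l.factorial : ℝ) ^ 3) ≤ Amax := by
    refine ⟨_, rfl, by positivity, fun l hl => mul_le_mul_of_nonneg_left (mul_le_mul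
      (pow_le_pow_right₀ hB hl) (pow_le_pow_left₀ (Nat.cast_nonneg _)
        (by exact_mod_cast Nat.factorial_le hl) 3) (by positivity) (pow_nonneg hB0 _)) zero_le_two⟩
  -- the registered constant dominates `2^(3t'+N) 4^t' Amax = 2^(5t'+N+1) B^t' (t'!)^3`
  have hconst : (2 : ℝ) ^ (3 * t' + N) * 4 ^ t' * Amax ≤
      (64 * B) ^ (t' + 1) * 2 ^ N * (t'.factorial : ℝ) ^ 3 := by
    have h1 : (2 : ℝ) ^ (3 * t' + N) * 4 ^ t' * 2 ≤ 64 ^ (t' + 1) * 2 ^ N := by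
      rw [show (4 : ℝ) = 2 ^ 2 by norm_num, show (64 : ℝ) = 2 ^ 6 by norm_num, ← pow_mul, ← pow_mul,
        ← pow_add, ← pow_succ, ← pow_add]
      exact pow_le_pow_right₀ one_le_two (by omega)
    have h2 : B ^ t' ≤ B ^ (t' + 1) := pow_le_pow_right₀ hB (Nat.le_succ _)
    calc (2 : ℝ) ^ (3 * t' + N) * 4 ^ t' * Amax
        = 2 ^ (3 * t' + N) * 4 ^ t' * 2 * B ^ t' * (t'.factorial : ℝ) ^ 3 := by rw [hAmaxB]; ring
      _ ≤ 64 ^ (t' + 1) * 2 ^ N * B ^ (t' + 1) * (t'.factorial : ℝ) ^ 3 :=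
        mul_le_mul_of_nonneg_right (mul_le_mul h1 h2 (pow_nonneg hB0 _) (by positivity))
          (by positivity)
      _ = (64 * B) ^ (t' + 1) * 2 ^ N * (t'.factorial : ℝ) ^ 3 := by rw [mul_pow]; ring
  rintro F hF hFc ⟨δ, hδ, hFδ⟩
  have hS0 := schwartzNorm_nonneg (2 * t' + N + 1) F
  -- the shells `u j = W j • F`
  have hsm : ∀ j, ContDiff ℝ ∞ fun y => W j y • F y := fun j => (hWs j).fun_smul (F.smooth ⊤)
  have hcs : ∀ j, HasCompactSupport fun y => W j y • F y := fun j => hFc.smul_left (f := W j)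
  obtain ⟨u, hu⟩ : ∃ u : ℕ → 𝓢((Fin n → EuclideanSpace ℝ (Fin 4)), ℂ), ∀ j y, u j y = W j y • F y :=
    ⟨fun j => (hcs j).toSchwartzMap (hsm j), fun j y => rfl⟩
  have hcoe : ∀ j, ((u j : 𝓢((Fin n → EuclideanSpace ℝ (Fin 4)), ℂ)) :
      (Fin n → EuclideanSpace ℝ (Fin 4)) → ℂ) = fun y => W j y • F y := fun j => funext (hu j)
  -- number of shells: `2⁻¹ ^ J' < δ`
  obtain ⟨J', hJ'⟩ : ∃ J' : ℕ, (2 : ℝ)⁻¹ ^ J' < δ := exists_pow_lt_of_lt_one hδ (by norm_num)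
  refine ⟨J' + 1, u, ?_, fun j => ⟨by rw [hcoe]; exact hcs j, ?_, ?_⟩⟩
  · -- telescoping: `Σ_{j ≤ J'} u j = η_{J'} F = F`
    ext x
    rw [sum_apply]
    simp only [hu, ← Finset.sum_smul]
    by_cases hx : x ∈ tsupport (F : (Fin n → EuclideanSpace ℝ (Fin 4)) → ℂ)
    · rw [hWsum J' x fun i i' hii' => hJ'.le.trans (hFδ x hx i i' hii'), one_smul]
    · rw [image_eq_zero_of_notMem_tsupport hx, smul_zero]
  · -- separation `≥ 2⁻¹ ^ (j+1)` on the support of the `j`-th shell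
    intro x hx i i' hii'
    by_contra hlt
    have hopen : IsOpen {y : Fin n → EuclideanSpace ℝ (Fin 4) | ‖y i - y i'‖ < (2 : ℝ)⁻¹ ^ (j + 1)} :=
      isOpen_lt (by fun_prop) continuous_const
    refine (notMem_tsupport_iff_eventuallyEq.2 ?_) hx
    filter_upwards [hopen.mem_nhds (not_le.mp hlt)] with y hy
    rw [hu, hW0 j y ⟨i, i', hii', hy⟩, zero_smul, Pi.zero_apply]
  · -- the Schwartz-norm bound on the `j`-th shell, first with the constant `2^(3t'+N) 4^t' Amax`
    have hmono := mul_le_mul_of_nonneg_right (mul_le_mul_of_nonneg_right hconst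
      (pow_nonneg (by norm_num : (0 : ℝ) ≤ 2⁻¹) (N * j))) hS0
    refine le_trans ?_ hmono
    refine schwartzNorm_le_of_pointwise (u j) (by positivity) fun k l hk hl x => ?_
    rw [hcoe j]
    rcases j with _ | j
    · -- `u 0 = η_0 F`: Leibniz with bounded cut-off derivatives, no flatness needed
      have hAc : ∀ c ≤ l, ‖iteratedFDeriv ℝ c (W 0) x‖ ≤ Amax * 2 ^ t' := fun c hc => by
        refine (hWC 0 c x).trans ?_
        rw [zero_add, one_mul]
        exact mul_le_mul (hAmax c (hc.trans hl)) (pow_le_pow_right₀ one_le_two (hc.trans hl))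
          (by positivity) hAmax0
      have hBm : ∀ m ≤ l, ‖x‖ ^ k * ‖iteratedFDeriv ℝ m F x‖ ≤ schwartzNorm (2 * t' + N + 1) F :=
        fun m hm => (SchwartzMap.le_seminorm ℂ k m F x).trans
          (seminorm_le_schwartzNorm (by omega) (by omega) F)
      refine (pow_mul_norm_iteratedFDeriv_smul_le_of_le (hWs 0) F (by positivity) x hAc hBm).trans ?_
      have h1 : (2 : ℝ) ^ (l + t') ≤ 2 ^ (3 * t' + N) := pow_le_pow_right₀ one_le_two (by omega)
      have h2 : (1 : ℝ) ≤ 4 ^ t' := one_le_pow₀ (by norm_num)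
      calc 2 ^ l * (Amax * 2 ^ t') * schwartzNorm (2 * t' + N + 1) F
          = 2 ^ (l + t') * 1 * Amax * schwartzNorm (2 * t' + N + 1) F := by ring
        _ ≤ 2 ^ (3 * t' + N) * 4 ^ t' * Amax * schwartzNorm (2 * t' + N + 1) F := by gcongr
        _ = 2 ^ (3 * t' + N) * 4 ^ t' * Amax * 2⁻¹ ^ (N * 0) * schwartzNorm (2 * t' + N + 1) F := by
            rw [mul_zero, pow_zero, mul_one]
    · by_cases hx : ∃ i i' : Fin n, i ≠ i' ∧ ‖x i - x i'‖ ≤ (2 : ℝ)⁻¹ ^ j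
      · -- near the locus: Leibniz, cut-off bounds `2^{(j+2) c}` and flatness of order `N + l + 1`
        obtain ⟨i, i', hii', hxi⟩ := hx
        have hAc : ∀ c ≤ l, ‖iteratedFDeriv ℝ c (W (j + 1)) x‖ ≤ Amax * 2 ^ ((j + 1 + 1) * l) :=
          fun c hc => (hWC (j + 1) c x).trans (mul_le_mul (hAmax c (hc.trans hl))
            (pow_le_pow_right₀ one_le_two (Nat.mul_le_mul_left _ hc)) (by positivity) hAmax0)
        have hBm : ∀ m ≤ l, ‖x‖ ^ k * ‖iteratedFDeriv ℝ m F x‖ ≤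
            4 ^ k * schwartzNorm (2 * t' + N + 1) F * ((2 : ℝ)⁻¹ ^ j) ^ (N + l + 1) := fun m hm =>
          pow_mul_norm_iteratedFDeriv_le_of_pair hF hii' hxi (pow_le_one₀ (by norm_num) (by norm_num))
            k (m := m) (M := N + l) (p := 2 * t' + N + 1) (by omega) (by omega)
        refine (pow_mul_norm_iteratedFDeriv_smul_le_of_le (hWs (j + 1)) F (by positivity) x hAc
          hBm).trans ?_
        have hexp : l + (j + 1 + 1) * l + N * (j + 1) ≤ 3 * t' + N + j * (N + l + 1) := by
          nlinarith [hl]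
        have hpow : (2 : ℝ) ^ (l + (j + 1 + 1) * l) * 2⁻¹ ^ (j * (N + l + 1)) ≤
            2 ^ (3 * t' + N) * 2⁻¹ ^ (N * (j + 1)) := two_pow_mul_inv_two_pow_le hexp
        have h4 : (4 : ℝ) ^ k ≤ 4 ^ t' := pow_le_pow_right₀ (by norm_num) hk
        calc 2 ^ l * (Amax * 2 ^ ((j + 1 + 1) * l)) *
              (4 ^ k * schwartzNorm (2 * t' + N + 1) F * ((2 : ℝ)⁻¹ ^ j) ^ (N + l + 1))
            = 4 ^ k * Amax * (2 ^ (l + (j + 1 + 1) * l) * 2⁻¹ ^ (j * (N + l + 1))) *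
                schwartzNorm (2 * t' + N + 1) F := by ring
          _ ≤ 4 ^ t' * Amax * (2 ^ (3 * t' + N) * 2⁻¹ ^ (N * (j + 1))) *
                schwartzNorm (2 * t' + N + 1) F := by gcongr
          _ = 2 ^ (3 * t' + N) * 4 ^ t' * Amax * 2⁻¹ ^ (N * (j + 1)) *
                schwartzNorm (2 * t' + N + 1) F := by ring
      · -- away from the locus `W (j+1) = 0` near `x`: the derivative vanishes
        push Not at hx
        have hev : ∀ᶠ y in 𝓝 x, ∀ i i' : Fin n, i ≠ i' → (2 : ℝ)⁻¹ ^ j ≤ ‖y i - y i'‖ := by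
          simp only [eventually_all]
          intro i i' hii'
          have hc : Continuous fun y : Fin n → EuclideanSpace ℝ (Fin 4) => ‖y i - y i'‖ := by fun_prop
          exact ((hc.tendsto x).eventually_const_lt (hx i i' hii')).mono fun _ hy => hy.le
        have h0 : (fun y => W (j + 1) y • F y) =ᶠ[𝓝 x]
            (0 : (Fin n → EuclideanSpace ℝ (Fin 4)) → ℂ) :=
          hev.mono fun y hy => by simp only [hW1 j y hy, zero_smul, Pi.zero_apply]
        rw [(h0.iteratedFDeriv ℝ l).eq_of_nhds, iteratedFDeriv_zero, Pi.zero_apply, norm_zero, mul_zero]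
        positivity

end Summit.QuantumFields.YangMills.Cruxes.HypercubicLimit.CouplingResponse

end
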